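import Mathlib
import HarnessLib
import Summits.HubbardSuperconductivity.HubbardSuperconductivity.Theorems.KLProgrammeKLRegimeTwoVolumeNormVKit

/-!
# Route `KLProgramme` — crux K3, VL child `KLRegimeVolumeLimitV17F2` (stmt-HubbardSuperconductivity-20440), blueprint v5 §3 / M5: THE PER-SCALE TWO-VOLUME BOUND
# IS ε-HOMOGENEOUS (seat hubbard-kl-k3c4-p1 g12; `--supports` 20440)

In the normalisation of record every block of the doubled analysis carries one factor `ε = imagTimeWeight β M`; the one-volume PROFILES of the tower are then
`ε ×` L-free budgets, the covariance ROW sums (a sum over the `2M` time slices) are `budget/ε`, the entry sups / sectional rows / Gram constants / overlap masses are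
ε-free, and the END door (p589727) divides the last defect by `ε`.  This file proves that the right-hand side of the per-scale step
(`…SrcSectorScaleSuccMinS/Bundled`), read as a formal expression, maps these scalings to EXACTLY one overall factor `ε`: `RHS(αW/ε, αW′/ε, ε·NV, ε·NW′, ε·Nw,
ε·Ein, ε·ν̄E; ε-free rest) = ε · RHS(αW, αW′, NV, NW′, Nw, Ein, ν̄E; rest)` — so the instance defect `ε⁻¹ × (defect)` of M5a obeys the spine's recursion with
L-free, M-free coefficients.  **`minS_rhs_eps_homog`**.  Pure real algebra (`normV` linearity, `…TwoVolumeNormVKit`); no definition.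
-/

noncomputable section

namespace Summit.HubbardSuperconductivity.HubbardSuperconductivity.Theorems.TwoVolumeDefect

set_option linter.dupNamespace false -- summit = problem name (single-conjunct summit), D-0017

open Finset Literature.MathematicalPhysics.QuantumLattice

/-- **ε-HOMOGENEITY OF THE PER-SCALE BOUND.**  MinS's right-hand side (`…SrcSectorScaleSuccMinS/Bundled`), as a formal expression in the covariance rows
`αW, αW′`, the profiles `NV, NW′, Nw, Ein`, the cap `νEbar` and the ε-free data, scales EXACTLY by `ε` under `αW ↦ αW/ε`, `αW′ ↦ αW′/ε`, profiles and cap `↦ ε·(·)`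
(`ε ≠ 0`): every smallness denominator is ε-invariant and every term carries net one factor `ε` (the D-currency normalisation of blueprint v5 §3: profiles are
`ε × budget`, rows are `budget/ε`, the END divides by `ε`). [folklore] -/
theorem minS_rhs_eps_homog (Γ' : Type) [Fintype Γ'] (n : ℕ) {ε : ℝ} (hε : ε ≠ 0) (aW aW' sW sW' eW' κ κ' ρ' ρ₂ ρf Λ νEbar : ℝ) (R R' : ℕ)
    (NV NW' Nw Ein : ℕ → ℝ) :
      (ρ'⁻¹ ^ (n + 1) * Real.exp 1 / (1 - Real.exp 1 * (aW' / ε) * (normV Γ' κ' ρ' (fun m' => ε * NV m' + (ε * NW' m' + ε * NV m')) + (ε * νEbar)) / κ' ^ 2) ^ 2) * normV Γ' κ' ρ' (fun m' => ε * Ein m') +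
        (ρ'⁻¹ ^ (n + 1) * (Real.exp 1 * normV Γ' κ' ρ' (fun m' => ε * NW' m' + ε * NV m')) / (1 - Real.exp 1 * (aW' / ε) * (normV Γ' κ' ρ' (fun m' => ε * NV m') + normV Γ' κ' ρ' (fun m' => ε * NW' m' + ε * NV m')) / κ' ^ 2) ^ 2) * (1 + Λ * ((R' : ℝ) + 1))⁻¹ +
        ((((n + 1 + 1) * (n + 1 + 2) : ℕ) : ℝ) / 2 *
            (ρ₂⁻¹ ^ (n + 3) * (Real.exp 1 * normV Γ' (κ' + κ + (κ' + κ + (κ' + κ))) ρ₂ (fun m' => ε * Nw m')) / (1 - Real.exp 1 * ((aW' / ε) + (aW / ε) + ((aW' / ε) + (aW / ε))) * normV Γ' (κ' + κ + (κ' + κ + (κ' + κ))) ρ₂ (fun m' => ε * Nw m') / (κ' + κ + (κ' + κ + (κ' + κ))) ^ 2))) * (eW' / (1 + Λ * ((R : ℝ) + 1))) +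
        (‖(2 : ℂ)⁻¹‖ * ∑ a ∈ range (n + 2), ∑ b ∈ range (n + 2),
            (if a + b = n + 1 then (((a + 1) * (b + 1) : ℕ) : ℝ) *
              (4 * (ρ₂⁻¹ ^ (a + 1) * (Real.exp 1 * normV Γ' (κ' + κ + (κ' + κ + (κ' + κ))) ρ₂ (fun m' => ε * Nw m')) / (1 - Real.exp 1 * ((aW' / ε) + (aW / ε) + ((aW' / ε) + (aW / ε))) * normV Γ' (κ' + κ + (κ' + κ + (κ' + κ))) ρ₂ (fun m' => ε * Nw m') / (κ' + κ + (κ' + κ + (κ' + κ))) ^ 2)) *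
                (ρ₂⁻¹ ^ (b + 1) * (Real.exp 1 * normV Γ' (κ' + κ + (κ' + κ + (κ' + κ))) ρ₂ (fun m' => ε * Nw m')) / (1 - Real.exp 1 * ((aW' / ε) + (aW / ε) + ((aW' / ε) + (aW / ε))) * normV Γ' (κ' + κ + (κ' + κ + (κ' + κ))) ρ₂ (fun m' => ε * Nw m') / (κ' + κ + (κ' + κ + (κ' + κ))) ^ 2))) else 0)) * ((aW' / ε) / (1 + Λ * ((R : ℝ) + 1))) +
        ((((n + 1 + 1) * (n + 1 + 2) : ℕ) : ℝ) / 2 * (sW' + sW) *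
              (ρf⁻¹ ^ (n + 3) * (Real.exp 1 * normV Γ' (κ' + κ) ρf (fun m' => ε * Nw m')) / (1 - Real.exp 1 * ((aW' / ε) + (aW / ε) + ((aW' / ε) + (aW / ε))) * normV Γ' (κ' + κ) ρf (fun m' => ε * Nw m') / (κ' + κ) ^ 2)) +
            ‖(2 : ℂ)⁻¹‖ * ∑ a ∈ range (n + 2), ∑ b ∈ range (n + 2),
              (if a + b = n + 1 then (((a + 1) * (b + 1) : ℕ) : ℝ) *
                (2 * ((aW' / ε) + (aW / ε)) * (ρf⁻¹ ^ (a + 1) * (Real.exp 1 * normV Γ' (κ' + κ) ρf (fun m' => ε * Nw m')) / (1 - Real.exp 1 * ((aW' / ε) + (aW / ε) + ((aW' / ε) + (aW / ε))) * normV Γ' (κ' + κ) ρf (fun m' => ε * Nw m') / (κ' + κ) ^ 2)) *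
                  (ρf⁻¹ ^ (b + 1) * (Real.exp 1 * normV Γ' (κ' + κ) ρf (fun m' => ε * Nw m')) / (1 - Real.exp 1 * ((aW' / ε) + (aW / ε) + ((aW' / ε) + (aW / ε))) * normV Γ' (κ' + κ) ρf (fun m' => ε * Nw m') / (κ' + κ) ^ 2))) else 0)) * (Λ * ((R' : ℝ) + 1))⁻¹ =
    ε * (      (ρ'⁻¹ ^ (n + 1) * Real.exp 1 / (1 - Real.exp 1 * aW' * (normV Γ' κ' ρ' (fun m' => NV m' + (NW' m' + NV m')) + νEbar) / κ' ^ 2) ^ 2) * normV Γ' κ' ρ' Ein +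
        (ρ'⁻¹ ^ (n + 1) * (Real.exp 1 * normV Γ' κ' ρ' (fun m' => NW' m' + NV m')) / (1 - Real.exp 1 * aW' * (normV Γ' κ' ρ' NV + normV Γ' κ' ρ' (fun m' => NW' m' + NV m')) / κ' ^ 2) ^ 2) * (1 + Λ * ((R' : ℝ) + 1))⁻¹ +
        ((((n + 1 + 1) * (n + 1 + 2) : ℕ) : ℝ) / 2 *
            (ρ₂⁻¹ ^ (n + 3) * (Real.exp 1 * normV Γ' (κ' + κ + (κ' + κ + (κ' + κ))) ρ₂ Nw) / (1 - Real.exp 1 * (aW' + aW + (aW' + aW)) * normV Γ' (κ' + κ + (κ' + κ + (κ' + κ))) ρ₂ Nw / (κ' + κ + (κ' + κ + (κ' + κ))) ^ 2))) * (eW' / (1 + Λ * ((R : ℝ) + 1))) +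
        (‖(2 : ℂ)⁻¹‖ * ∑ a ∈ range (n + 2), ∑ b ∈ range (n + 2),
            (if a + b = n + 1 then (((a + 1) * (b + 1) : ℕ) : ℝ) *
              (4 * (ρ₂⁻¹ ^ (a + 1) * (Real.exp 1 * normV Γ' (κ' + κ + (κ' + κ + (κ' + κ))) ρ₂ Nw) / (1 - Real.exp 1 * (aW' + aW + (aW' + aW)) * normV Γ' (κ' + κ + (κ' + κ + (κ' + κ))) ρ₂ Nw / (κ' + κ + (κ' + κ + (κ' + κ))) ^ 2)) *
                (ρ₂⁻¹ ^ (b + 1) * (Real.exp 1 * normV Γ' (κ' + κ + (κ' + κ + (κ' + κ))) ρ₂ Nw) / (1 - Real.exp 1 * (aW' + aW + (aW' + aW)) * normV Γ' (κ' + κ + (κ' + κ + (κ' + κ))) ρ₂ Nw / (κ' + κ + (κ' + κ + (κ' + κ))) ^ 2))) else 0)) * (aW' / (1 + Λ * ((R : ℝ) + 1))) +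
        ((((n + 1 + 1) * (n + 1 + 2) : ℕ) : ℝ) / 2 * (sW' + sW) *
              (ρf⁻¹ ^ (n + 3) * (Real.exp 1 * normV Γ' (κ' + κ) ρf Nw) / (1 - Real.exp 1 * (aW' + aW + (aW' + aW)) * normV Γ' (κ' + κ) ρf Nw / (κ' + κ) ^ 2)) +
            ‖(2 : ℂ)⁻¹‖ * ∑ a ∈ range (n + 2), ∑ b ∈ range (n + 2),
              (if a + b = n + 1 then (((a + 1) * (b + 1) : ℕ) : ℝ) *
                (2 * (aW' + aW) * (ρf⁻¹ ^ (a + 1) * (Real.exp 1 * normV Γ' (κ' + κ) ρf Nw) / (1 - Real.exp 1 * (aW' + aW + (aW' + aW)) * normV Γ' (κ' + κ) ρf Nw / (κ' + κ) ^ 2)) *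
                  (ρf⁻¹ ^ (b + 1) * (Real.exp 1 * normV Γ' (κ' + κ) ρf Nw) / (1 - Real.exp 1 * (aW' + aW + (aW' + aW)) * normV Γ' (κ' + κ) ρf Nw / (κ' + κ) ^ 2))) else 0)) * (Λ * ((R' : ℝ) + 1))⁻¹) := by
  -- every `normV` is linear in the profile
  have hN : ∀ (K ρ : ℝ) (F : ℕ → ℝ), normV Γ' K ρ (fun m' => ε * F m') = ε * normV Γ' K ρ F := fun K ρ F => normV_const_mul K ρ ε F
  have h1 : normV Γ' κ' ρ' (fun m' => ε * NV m' + (ε * NW' m' + ε * NV m')) = ε * normV Γ' κ' ρ' (fun m' => NV m' + (NW' m' + NV m')) := by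
    rw [← normV_const_mul]; congr 1; funext m; ring
  have h2 : normV Γ' κ' ρ' (fun m' => ε * NW' m' + ε * NV m') = ε * normV Γ' κ' ρ' (fun m' => NW' m' + NV m') := by
    rw [← normV_const_mul]; congr 1; funext m; ring
  rw [h1, h2, hN, hN, hN, hN]
  -- the smallness lines are ε-invariant
  have hθ₁ : Real.exp 1 * (aW' / ε) * (ε * normV Γ' κ' ρ' (fun m' => NV m' + (NW' m' + NV m')) + ε * νEbar) =
      Real.exp 1 * aW' * (normV Γ' κ' ρ' (fun m' => NV m' + (NW' m' + NV m')) + νEbar) := by field_simp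
  have hθ₂' : Real.exp 1 * (aW' / ε) * (ε * normV Γ' κ' ρ' NV + ε * normV Γ' κ' ρ' (fun m' => NW' m' + NV m')) =
      Real.exp 1 * aW' * (normV Γ' κ' ρ' NV + normV Γ' κ' ρ' (fun m' => NW' m' + NV m')) := by field_simp
  have hα : (aW' / ε) + (aW / ε) + ((aW' / ε) + (aW / ε)) = (aW' + aW + (aW' + aW)) / ε := by field_simp
  have hθ₂ : ∀ (K ρ : ℝ), Real.exp 1 * ((aW' + aW + (aW' + aW)) / ε) * (ε * normV Γ' K ρ Nw) = Real.exp 1 * (aW' + aW + (aW' + aW)) * normV Γ' K ρ Nw :=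
    fun K ρ => by field_simp
  rw [hθ₁, hθ₂', hα, hθ₂, hθ₂]
  -- the scaled bracket bounds are `ε ×` the unscaled ones
  have hB : ∀ (K ρ θ : ℝ) (k : ℕ), ρ⁻¹ ^ k * (Real.exp 1 * (ε * normV Γ' K ρ Nw)) / (1 - θ) = ε * (ρ⁻¹ ^ k * (Real.exp 1 * normV Γ' K ρ Nw) / (1 - θ)) :=
    fun K ρ θ k => by ring
  simp only [hB]
  -- the two double sums: normalise the summands, pull the powers of `ε` out
  have h4 : ∀ x y : ℝ, 4 * (ε * x) * (ε * y) = ε ^ 2 * (4 * x * y) := fun x y => by ring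
  have h2 : ∀ x y : ℝ, 2 * (aW' / ε + aW / ε) * (ε * x) * (ε * y) = ε * (2 * (aW' + aW) * x * y) := fun x y => by field_simp
  have hif : ∀ (a b : ℕ) (c f : ℝ), (if a + b = n + 1 then (((a + 1) * (b + 1) : ℕ) : ℝ) * (c * f) else 0) =
      c * (if a + b = n + 1 then (((a + 1) * (b + 1) : ℕ) : ℝ) * f else 0) := fun a b c f => by split_ifs <;> ring
  simp only [h4, h2, hif, ← Finset.mul_sum]
  field_simp

end Summit.HubbardSuperconductivity.HubbardSuperconductivity.Theorems.TwoVolumeDefect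

end
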